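import Literature.MathematicalPhysics.QuantumLattice.HubbardTPPObjectMCapBoxWordsVec
import Literature.MathematicalPhysics.QuantumLattice.HubbardTTPrimeAnchorWordBoxTransport
import HarnessLib

/-!
# Object-M FLOOR words on `(U, t', t'', n)` boxes from `t''`-exact corner rows (monotone in `U`, concave in `(t', t'')`)

Topic `MathematicalPhysics/QuantumLattice`, family `hubbard`. Companion of `HubbardTPPObjectMCapBoxWords` (the CAP
side). There the FLOOR of an object-M word (`e^M(t, t', t'', U; ρ) = tiGroundEnergyDensityAt 2 ρ` of Pavarini's
`t–t'–t''` interaction) was transported from a `t–t'` floor with the kinematic `(16/π²)·|t''|` allowance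
(`tpp_floor_box₄_of_floor_Icc₃`). Here the floor is read from rows that are EXACT in `t''` — e.g. the infinite-volume
Anderson cluster bound `InfVolFermionState.tiGroundEnergyDensityAt_tpp_ge_of_boxFloors_2x3_oneTable` fed by kernel
`t–t'–t''` cluster certificates (`HubbardOpenBoxTPPClusterOracle`) — at the four `(t', t'')` corners of the box at its
LOWER `U` edge:

* §1 **`tiGroundEnergyDensityAt_tpp_mono_U`**: `e^M` is non-decreasing in `U` (its `U`-slope is the double occupancy
  `D ≥ 0`; Griffiths 1966 §II);
* §2 the `(t', t'')` LINEAR FAMILY `hubbardTT'T''FermionInteraction_eq_linearFamily_sr` and the box rule at fixed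
  `(t, U, ρ)`: floors at the four `(t', t'')` corners hold on the rectangle (`tpp_floor_sr_of_corners`; joint concavity,
  Rockafellar Thm 32.2 via `le_tiGroundEnergyDensityAt_linearFamily_of_mem_Icc`);
* §3 **`tpp_floor₄_of_cornerRowsLo`**: four affine density rows at `(U₁, sᵢ, rⱼ)` and a constant `L` below their
  eight endpoint values ⇒ `L ≤ e^M(1, s, r, u; n)` on the whole 4-box (`u ≥ U₁`), in the `∀ u s r n` shape of
  `tpp_word_Icc₄_of_forall₄`; `tpp_word₄_of_floor₄_of_cap₄` pairs it with a cap.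

Everything is proved; no named fact; no definition with numerical content.

## References

* R. B. Griffiths, J. Math. Phys. 5 (1964) 1215 / Phys. Rev. 1966, §II (monotonicity / convexity in couplings). [cite: Griffiths1966, §II]
* R. T. Rockafellar, Convex Analysis (1970), Thm 32.2. [cite: Rockafellar1970, Thm 32.2]
* R. B. Israel, Convexity in the Theory of Lattice Gases (1979), Thm. I.3.4. [cite: Israel1979, Thm. I.3.4]
* E. Pavarini et al., PRL 87 (2001) 047003, eq. (1). [cite: PavariniEtAl2001, eq. (1)]
-/

noncomputable section

namespace Literature.MathematicalPhysics.QuantumLattice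

open Set ThermodynamicLimit

/-! ### §1 Monotonicity in `U` -/

/-- **Object M is non-decreasing in `U`**: `U₁ ≤ U₂ ⇒ e^M(t,t',t'',U₁; ρ) ≤ e^M(t,t',t'',U₂; ρ)` (`0 < ρ < 2`): for every
state the mean energy is affine in `U` with slope the double-occupancy density `D(ω) ≥ 0`. [cite: Griffiths1966, §II] -/
theorem tiGroundEnergyDensityAt_tpp_mono_U (t t' t'' : ℝ) {ρ : ℝ} (hρ0 : 0 < ρ) (hρ2 : ρ < 2) {U₁ U₂ : ℝ} (hU : U₁ ≤ U₂) :
    (hubbardTT'T''FermionInteraction t t' t'' U₁).tiGroundEnergyDensityAt 2 ρ ≤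
      (hubbardTT'T''FermionInteraction t t' t'' U₂).tiGroundEnergyDensityAt 2 ρ := by
  obtain ⟨ω, hω, hρ⟩ := exists_isTranslationInvariant_density_eq hρ0 hρ2
  refine FermionInteraction.le_tiGroundEnergyDensityAt _ _ ⟨ω, hω, hρ⟩ fun σ hσ hσρ => ?_
  refine (FermionInteraction.tiGroundEnergyDensityAt_le_meanEnergy _ _ hσ hσρ).trans ?_
  have e1 : σ.meanEnergy (hubbardTTPrimeFermionInteraction t t' U₁) 2 = σ.meanEnergy (hubbardTTPrimeFermionInteraction t t' U₁) 1 :=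
    σ.meanEnergy_eq_of_le _ (by norm_num) fun X h0 hX => hubbardTTPrimeFermionInteraction_apply_eq_zero_of_not_subset t t' U₁ h0 hX
  have e2 : σ.meanEnergy (hubbardTTPrimeFermionInteraction t t' U₂) 2 = σ.meanEnergy (hubbardTTPrimeFermionInteraction t t' U₂) 1 :=
    σ.meanEnergy_eq_of_le _ (by norm_num) fun X h0 hX => hubbardTTPrimeFermionInteraction_apply_eq_zero_of_not_subset t t' U₂ h0 hX
  rw [InfVolFermionState.meanEnergy_hubbardTT'T'', InfVolFermionState.meanEnergy_hubbardTT'T'', e1, e2,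
    σ.meanEnergy_hubbardTTPrime_affine t t' U₁ t' U₂]
  have hD := σ.meanEnergy_hubbardTTPrime_onSite_nonneg
  nlinarith

/-! ### §2 The `(t', t'')` linear family and the rectangle rule -/

/-- The two coupling directions `Φ(0,1,0)` (diagonal hopping) and `Φ''(1)` (axial range-2 hopping) of the `(t', t'')`
family at fixed `(t, U)`. [cite: PavariniEtAl2001, eq. (1)] -/
def hubbardTPPDirectionsSR : Fin 2 → FermionInteraction 2 :=
  ![hubbardTTPrimeFermionInteraction 0 1 0, axialRange2HoppingFermionInteraction 2 1]

/-- **The `t–t'–t''` interaction is a linear family in `(t', t'')`** with base `Φ(t, 0, 0, U)`: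
`Φ(t, θ₀, θ₁, U) = linearFamily Φ(t,0,0,U) (Φ(0,1,0), Φ'') θ`. [cite: PavariniEtAl2001, eq. (1)] -/
theorem hubbardTT'T''FermionInteraction_eq_linearFamily_sr (t U : ℝ) (θ : Fin 2 → ℝ) :
    hubbardTT'T''FermionInteraction t (θ 0) (θ 1) U =
      FermionInteraction.linearFamily (hubbardTT'T''FermionInteraction t 0 0 U) hubbardTPPDirectionsSR θ := by
  refine FermionInteraction.ext fun X => ?_
  rw [FermionInteraction.linearFamily_apply, Fin.sum_univ_two]
  simp only [hubbardTPPDirectionsSR, Matrix.cons_val_zero, Matrix.cons_val_one]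
  rw [hubbardTT'T''FermionInteraction, hubbardTT'T''FermionInteraction, FermionInteraction.pencil_apply,
    FermionInteraction.pencil_apply, Complex.ofReal_zero, zero_smul, add_zero]
  have h1 : (hubbardTTPrimeFermionInteraction t (θ 0) U).Φ X =
      (hubbardTTPrimeFermionInteraction t 0 U).Φ X + ((θ 0 : ℝ) : ℂ) • (hubbardTTPrimeFermionInteraction 0 1 0).Φ X := by
    have ha := hubbardTTPrimeFermionInteraction_add t 0 0 (θ 0) U 0 X
    have hs := hubbardTTPrimeFermionInteraction_smul (θ 0) 0 1 0 X
    rw [mul_zero, mul_one] at hs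
    rw [add_zero, zero_add, add_zero, hs] at ha
    exact ha
  rw [h1]
  abel

/-- **Rectangle rule at fixed `(t, U, ρ)`**: a floor certified at the four `(t', t'')` corners holds on the rectangle
(joint concavity of `e^M` in the couplings). [cite: Rockafellar1970, Thm 32.2] -/
theorem tpp_floor_sr_of_corners {t U s₁ s₂ r₁ r₂ ρ L : ℝ}
    (h11 : L ≤ (hubbardTT'T''FermionInteraction t s₁ r₁ U).tiGroundEnergyDensityAt 2 ρ)
    (h12 : L ≤ (hubbardTT'T''FermionInteraction t s₁ r₂ U).tiGroundEnergyDensityAt 2 ρ)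
    (h21 : L ≤ (hubbardTT'T''FermionInteraction t s₂ r₁ U).tiGroundEnergyDensityAt 2 ρ)
    (h22 : L ≤ (hubbardTT'T''FermionInteraction t s₂ r₂ U).tiGroundEnergyDensityAt 2 ρ)
    {s r : ℝ} (hs : s ∈ Set.Icc s₁ s₂) (hr : r ∈ Set.Icc r₁ r₂) :
    L ≤ (hubbardTT'T''FermionInteraction t s r U).tiGroundEnergyDensityAt 2 ρ := by
  classical
  have e := hubbardTT'T''FermionInteraction_eq_linearFamily_sr t U ![s, r]
  simp only [Matrix.cons_val_zero, Matrix.cons_val_one] at e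
  rw [e]
  refine FermionInteraction.le_tiGroundEnergyDensityAt_linearFamily_of_mem_Icc _ _ 2 ρ ![s₁, r₁] ![s₂, r₂] ?_
    (θ := ![s, r]) ⟨fun a => ?_, fun a => ?_⟩
  · intro v hv
    have h0 := Fintype.mem_piFinset.1 hv 0
    have h1 := Fintype.mem_piFinset.1 hv 1
    simp only [Matrix.cons_val_zero, Matrix.cons_val_one, Finset.mem_insert, Finset.mem_singleton] at h0 h1
    rw [← hubbardTT'T''FermionInteraction_eq_linearFamily_sr t U v]
    rcases h0 with h0 | h0 <;> rcases h1 with h1 | h1 <;> rw [h0, h1]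
    · exact h11
    · exact h12
    · exact h21
    · exact h22
  · fin_cases a
    · exact hs.1
    · exact hr.1
  · fin_cases a
    · exact hs.2
    · exact hr.2

/-! ### §3 The floor device on a 4-box -/

/-- An affine function on an interval is bounded below by its smaller endpoint value. [folklore] -/
private theorem affine_ge_of_endpoints {A B n₁ n₂ n L : ℝ} (h1 : L ≤ A + B * n₁) (h2 : L ≤ A + B * n₂)
    (hn₁ : n₁ ≤ n) (hn₂ : n ≤ n₂) : L ≤ A + B * n := by
  rcases le_total 0 B with hB | hB
  · nlinarith
  · nlinarith

/-- **FLOOR on a `(U, t', t'', n)` box from four `t''`-exact corner rows at the lower `U` edge.** If at the four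
corners `(U₁, sᵢ, rⱼ)` affine density rows `A + B·ρ ≤ e^M(1, sᵢ, rⱼ, U₁; ρ)` hold for `ρ ∈ [n₁, n₂]` (`0 < n₁`, `n₂ < 2`)
and `L` lies below all eight endpoint values, then `L ≤ e^M(1, s, r, u; n)` for every `(u, s, r, n)` of the box
`[U₁,U₂]×[s₁,s₂]×[r₁,r₂]×[n₁,n₂]` (rows ⇒ corners at each `n`; rectangle rule in `(t', t'')`; monotone in `U`).
[cite: Rockafellar1970, Thm 32.2] [cite: Griffiths1966, §II] -/
theorem tpp_floor₄_of_cornerRowsLo {U₁ U₂ s₁ s₂ r₁ r₂ n₁ n₂ A₁₁ B₁₁ A₁₂ B₁₂ A₂₁ B₂₁ A₂₂ B₂₂ L : ℝ}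
    (hn0 : 0 < n₁) (hn2 : n₂ < 2)
    (h11 : ∀ ρ ∈ Set.Icc n₁ n₂, A₁₁ + B₁₁ * ρ ≤ (hubbardTT'T''FermionInteraction 1 s₁ r₁ U₁).tiGroundEnergyDensityAt 2 ρ)
    (h12 : ∀ ρ ∈ Set.Icc n₁ n₂, A₁₂ + B₁₂ * ρ ≤ (hubbardTT'T''FermionInteraction 1 s₁ r₂ U₁).tiGroundEnergyDensityAt 2 ρ)
    (h21 : ∀ ρ ∈ Set.Icc n₁ n₂, A₂₁ + B₂₁ * ρ ≤ (hubbardTT'T''FermionInteraction 1 s₂ r₁ U₁).tiGroundEnergyDensityAt 2 ρ)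
    (h22 : ∀ ρ ∈ Set.Icc n₁ n₂, A₂₂ + B₂₂ * ρ ≤ (hubbardTT'T''FermionInteraction 1 s₂ r₂ U₁).tiGroundEnergyDensityAt 2 ρ)
    (l11a : L ≤ A₁₁ + B₁₁ * n₁) (l11b : L ≤ A₁₁ + B₁₁ * n₂) (l12a : L ≤ A₁₂ + B₁₂ * n₁) (l12b : L ≤ A₁₂ + B₁₂ * n₂)
    (l21a : L ≤ A₂₁ + B₂₁ * n₁) (l21b : L ≤ A₂₁ + B₂₁ * n₂) (l22a : L ≤ A₂₂ + B₂₂ * n₁) (l22b : L ≤ A₂₂ + B₂₂ * n₂) :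
    ∀ u s r n : ℝ, U₁ ≤ u → u ≤ U₂ → s₁ ≤ s → s ≤ s₂ → r₁ ≤ r → r ≤ r₂ → n₁ ≤ n → n ≤ n₂ →
      L ≤ (hubbardTT'T''FermionInteraction 1 s r u).tiGroundEnergyDensityAt 2 n := by
  intro u s r n hu₁ _ hs₁ hs₂ hr₁ hr₂ hm₁ hm₂
  have hn0' : 0 < n := lt_of_lt_of_le hn0 hm₁
  have hn2' : n < 2 := lt_of_le_of_lt hm₂ hn2
  have hmem : n ∈ Set.Icc n₁ n₂ := ⟨hm₁, hm₂⟩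
  have c11 := (affine_ge_of_endpoints l11a l11b hm₁ hm₂).trans (h11 n hmem)
  have c12 := (affine_ge_of_endpoints l12a l12b hm₁ hm₂).trans (h12 n hmem)
  have c21 := (affine_ge_of_endpoints l21a l21b hm₁ hm₂).trans (h21 n hmem)
  have c22 := (affine_ge_of_endpoints l22a l22b hm₁ hm₂).trans (h22 n hmem)
  exact (tpp_floor_sr_of_corners c11 c12 c21 c22 ⟨hs₁, hs₂⟩ ⟨hr₁, hr₂⟩).trans
    (tiGroundEnergyDensityAt_tpp_mono_U 1 s r hn0' hn2' hu₁)

/-- **Two-sided word from a floor and a cap in the `∀ u s r n` shape** (feed `tpp_word_Icc₄_of_forall₄`).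
[cite: Ruelle1969, §3.4] -/
theorem tpp_word₄_of_floor₄_of_cap₄ {U₁ U₂ s₁ s₂ r₁ r₂ n₁ n₂ L R : ℝ}
    (hL : ∀ u s r n : ℝ, U₁ ≤ u → u ≤ U₂ → s₁ ≤ s → s ≤ s₂ → r₁ ≤ r → r ≤ r₂ → n₁ ≤ n → n ≤ n₂ →
      L ≤ (hubbardTT'T''FermionInteraction 1 s r u).tiGroundEnergyDensityAt 2 n)
    (hR : ∀ u s r n : ℝ, U₁ ≤ u → u ≤ U₂ → s₁ ≤ s → s ≤ s₂ → r₁ ≤ r → r ≤ r₂ → n₁ ≤ n → n ≤ n₂ →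
      (hubbardTT'T''FermionInteraction 1 s r u).tiGroundEnergyDensityAt 2 n ≤ R) :
    ∀ u s r n : ℝ, U₁ ≤ u → u ≤ U₂ → s₁ ≤ s → s ≤ s₂ → r₁ ≤ r → r ≤ r₂ → n₁ ≤ n → n ≤ n₂ →
      L ≤ (hubbardTT'T''FermionInteraction 1 s r u).tiGroundEnergyDensityAt 2 n ∧
        (hubbardTT'T''FermionInteraction 1 s r u).tiGroundEnergyDensityAt 2 n ≤ R :=
  fun u s r n h₁ h₂ h₃ h₄ h₅ h₆ h₇ h₈ =>
    ⟨hL u s r n h₁ h₂ h₃ h₄ h₅ h₆ h₇ h₈, hR u s r n h₁ h₂ h₃ h₄ h₅ h₆ h₇ h₈⟩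

end Literature.MathematicalPhysics.QuantumLattice
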